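import Mathlib
import Literature.Computability.QuantumComplexity.Forrelation
import Literature.Computability.QuantumComplexity.CubicForrelation
import Literature.Computability.QuantumComplexity.ForrelationDerivativeTables

/-!
# Sketch — crux `NearExactIsExact` (stmt-QuantumAdvantage-14043), crux-ideate round 1, ideator 3

First lemmas of the three idea cards (statements only; each `def … : Prop` must elaborate):

* card `dyadic-table-incidence-rigidity`: `DyadicTable`, `DisagreementMass`, `UniformRowDefect`,
  `RadicalCapture`;
* card `defect-divisible-design`: `DefectDivisibility`, `SmallDefectVanishes`;
* card `coset-affine-extraction`: `AlignedCapture`, `CosetAffineExtraction`.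

Notation: `T_f(h,u) = dwt (signOf ∘ f) h u = Σ_x (−1)^{f x + f (x ⊕ h) + u·x}` (the derivative Walsh
table of `ForrelationDerivativeTables.lean`), `W` the unnormalised Walsh transform, `Φ = forrelation`.
-/

namespace Summit.QuantumAdvantage.QuantumAdvantage.Cruxes.NearExactIsExact.Ideator3

open Finset
open Literature.Computability.QuantumComplexity
open Literature.Computability.QuantumComplexity.DerivativeWalsh

/-- coordinatewise xor of two bit vectors (local copy, to stay independent of which `bxor` is open). -/
def bx {n : ℕ} (x a : Fin n → Bool) : Fin n → Bool := fun i => xor (x i) (a i)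

/-- `(−1)^{f}` as a real function. -/
noncomputable def sgnF {n : ℕ} (f : (Fin n → Bool) → Bool) : (Fin n → Bool) → ℝ := fun x => signOf (f x)

/-- dot product parity `u·x` as a Bool. -/
def dotB {n : ℕ} (u x : Fin n → Bool) : Bool :=
  (Finset.univ.filter fun i => u i && x i).card % 2 == 1

/-! ## Card A — dyadic-table-incidence-rigidity -/

/-- **DyadicTable** (card A, first lemma). For a CUBIC `f` on an EVEN number `n` of bits every entry of
the derivative Walsh table is `0` or `±2^{n/2 + j}` with an INTEGER `j ≥ 1`: for `h ≠ 0` the quadratic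
`D_h f` has the alternating form `T_f(h,·,·)` whose radical contains `h` and has even codimension, so its
dimension `k = 2j ≥ 2` (Carlet 2020 Prop. 55 = tree fact `carlet2020_prop55`); for `h = 0` the entry is
`2ⁿ·[u = 0]` (so `n ≥ 2` is needed: at `n = 0` the single entry is `1`). Consequence: two DISTINCT
admissible values differ by at least `2^{n/2+1}`. -/
def DyadicTable : Prop :=
  ∀ n : ℕ, Even n → 0 < n → ∀ f : (Fin n → Bool) → Bool, IsDegLeFun 3 f →
    ∀ h u : Fin n → Bool,
      dwt (sgnF f) h u = 0 ∨ ∃ j : ℕ, 1 ≤ j ∧ dwt (sgnF f) h u ^ 2 = (2 : ℝ) ^ (n + 2 * j)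

/-- **DisagreementMass** (card A). With `Δ(h,u) = T_f(h,u) − T_g(u,h)` one has
`Σ_{h,u} Δ² = 2·8ⁿ·(1 − Φ(f,g)²)` (tree: `sum_sq_sub_eq`, `two_pow_mul_forrelation_sq`), and by
`DyadicTable` every nonzero `Δ(h,u)` has `Δ² ≥ 4·2ⁿ`; hence the number of disagreeing cells is at most
`(1 − Φ²)·4ⁿ/2`, and — the scale-free form used by the line — in every row `h` the cells where the
`f`-entry is nonzero and differs from the `g`-entry number at most `η(h)/2` times the row support
`2^{n − 2 j_f(h)}`, where `η(h) = Σ_u Δ(h,u)²/4ⁿ` and `E_h η(h) = 2(1 − Φ²)`. Filed: the global count. -/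
def DisagreementMass : Prop :=
  ∀ n : ℕ, Even n → ∀ f g : (Fin n → Bool) → Bool, IsDegLeFun 3 f → IsDegLeFun 3 g →
    (4 : ℝ) * 2 ^ n *
        ((Finset.univ.filter fun p : (Fin n → Bool) × (Fin n → Bool) =>
            dwt (sgnF f) p.1 p.2 ≠ dwt (sgnF g) p.2 p.1).card : ℝ)
      ≤ 2 * (2 : ℝ) ^ (3 * n) * (1 - forrelation f g ^ 2)

/-- **UniformRowDefect** (card A, "no bad direction"). Let `ρ(x) = (−1)^{f x}·2^{-n/2} W_g(x)` (so
`E ρ = Φ`, `E ρ² = 1`) and `R(h) = E_x ρ(x)ρ(x ⊕ h) = 4^{-n} Σ_u T_f(h,u) T_g(u,h)` (row correlation;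
`E_h R = Φ²`). Then `ℓ(h) = √(1 − R(h)) = ‖ρ − τ_h ρ‖/√2` is subadditive on `𝔽₂ⁿ`, and Markov +
pigeonhole (`{ℓ ≤ r}` has density `> 1/2` once `r² > 2(1−Φ²)`, so `{ℓ ≤ r} + {ℓ ≤ r} = 𝔽₂ⁿ`) give the
UNIFORM bound `1 − R(h) ≤ 8·(1 − Φ²)` for EVERY `h`. Valid for all Boolean `f, g` (no degree needed). -/
def UniformRowDefect : Prop :=
  ∀ n : ℕ, ∀ f g : (Fin n → Bool) → Bool, ∀ h : Fin n → Bool,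
    (4 : ℝ) ^ n - ∑ u : Fin n → Bool, dwt (sgnF f) h u * dwt (sgnF g) u h
      ≤ 8 * (4 : ℝ) ^ n * (1 - forrelation f g ^ 2)

/-- **RadicalCapture** (card A, the bounded-degree capture sub-lemma (KER)). For cubic `f` the third
derivative `D_h D_v D_w f` is a CONSTANT `T_f(h,v,w)` (the alternating trilinear form). If an affine map
`u ↦ M u ⊕ c` lands in the radical of `T_f(u,·,·)` for MORE THAN 3/4 of all `u`, it does so for every
`u`: `u ↦ T_f(u, Mu ⊕ c, w)` has degree `≤ 2` in `u`, and a nonzero function of degree `≤ 2` vanishes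
on at most `3/4` of the points (d_min RM(2,n) = 2^{n−2}). -/
def RadicalCapture : Prop :=
  ∀ n : ℕ, ∀ f : (Fin n → Bool) → Bool, IsDegLeFun 3 f →
    ∀ (M : Matrix (Fin n) (Fin n) (ZMod 2)) (c : Fin n → Bool),
      let A : (Fin n → Bool) → (Fin n → Bool) := fun u i =>
        xor (decide (M.mulVec (fun j => if u j then (1 : ZMod 2) else 0) i = 1)) (c i)
      (4 * (Finset.univ.filter fun u : Fin n → Bool =>
            ∀ w x : Fin n → Bool,
              xor (xor (xor (f x) (f (bx x u))) (xor (f (bx x (A u))) (f (bx (bx x u) (A u)))))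
                  (xor (xor (f (bx x w)) (f (bx (bx x w) u)))
                       (xor (f (bx (bx x w) (A u))) (f (bx (bx (bx x w) u) (A u))))) = false).card
          > 3 * 2 ^ n) →
        ∀ u w x : Fin n → Bool,
          xor (xor (xor (f x) (f (bx x u))) (xor (f (bx x (A u))) (f (bx (bx x u) (A u)))))
              (xor (xor (f (bx x w)) (f (bx (bx x w) u)))
                   (xor (f (bx (bx x w) (A u))) (f (bx (bx (bx x w) u) (A u))))) = false

/-! ## Card B — defect-divisible-design -/

/-- **DefectDivisibility** (card B, first lemma; the bent branch). If `g` is cubic and bent with dual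
`gt` (`W_g = 2^m (−1)^{gt}` on `n = m + m` bits) and `f` is cubic, put `S = {f ≠ gt}` (so
`Φ(f,g) = 1 − 2|S|/2ⁿ`). Then for EVERY shift `a` and frequency `u` the derivative-twisted character sum
over the difference set `S Δ (S ⊕ a)` is divisible by `2^m = 2^{n/2}`:
`Σ_{x ∈ S Δ (S⊕a)} (−1)^{f x + f(x⊕a) + u·x} ≡ 0 (mod 2^{n/2})`.
Proof sketch: `T_g(u,a) = W_{D_a gt}(u)` (bent duality of the tables) and
`W_{D_a gt}(u) − W_{D_a f}(u) = −2·(this sum)`, while both table entries lie in `{0, ±2^{m+j}, j ≥ 1}`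
(`DyadicTable` for `f` AND for `g`), whose pairwise differences are multiples of `2^{m+1}`. -/
def DefectDivisibility : Prop :=
  ∀ m : ℕ, ∀ f g gt : (Fin (m + m) → Bool) → Bool, IsDegLeFun 3 f → IsDegLeFun 3 g →
    (∀ x, W (sgnF g) x = (2 : ℝ) ^ m * signOf (gt x)) →
    ∀ a u : Fin (m + m) → Bool, ∃ k : ℤ,
      (∑ x ∈ Finset.univ.filter (fun x : Fin (m + m) → Bool =>
              (f x != gt x) != (f (bx x a) != gt (bx x a))),
          signOf (f x) * signOf (f (bx x a)) * signOf (dotB u x)) = (k : ℝ) * (2 : ℝ) ^ m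

/-- **SmallDefectVanishes** (card B, the immediate corollary that the line must upgrade from
`2^{n/2−1}` to a constant fraction): in the situation of `DefectDivisibility`, if `0 < |S| < 2^{m−1}`
is impossible — a sum of fewer than `2^m` signs that is a multiple of `2^m` vanishes, for all `a,u`,
so `1_{SΔ(S⊕a)} ≡ 0` for all `a`, i.e. `S ∈ {∅, 𝔽₂ⁿ}`. (Kolomeec-type bound re-derived 2-adically;
the card's target is `|S| < 2ⁿ/16 ⇒ S = ∅` via the structure of `2^{n/2}`-divisible signed sets.) -/
def SmallDefectVanishes : Prop :=
  ∀ m : ℕ, ∀ f g gt : (Fin (m + m) → Bool) → Bool, IsDegLeFun 3 f → IsDegLeFun 3 g →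
    (∀ x, W (sgnF g) x = (2 : ℝ) ^ m * signOf (gt x)) →
    2 * (Finset.univ.filter fun x : Fin (m + m) → Bool => f x ≠ gt x).card < 2 ^ m →
      (∀ x, f x = gt x)

/-! ## Card C — coset-affine-extraction -/

/-- `f` is affine on every coset of the subspace spanned by the columns listed in `B` (a basis given as
`m` vectors): all second derivatives in directions from `B` vanish. -/
def AffineOnCosets {n m : ℕ} (f : (Fin n → Bool) → Bool) (B : Fin m → (Fin n → Bool)) : Prop :=
  ∀ i j : Fin m, ∀ x : Fin n → Bool,
    xor (xor (f x) (f (bx x (B i)))) (xor (f (bx x (B j))) (f (bx (bx x (B i)) (B j)))) = false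

/-- **AlignedCapture** (card C, the rigorous closing step, on paper): if on `n = m+m` bits `f` is affine
on the cosets of an `m`-dimensional subspace `U` and `g` is affine on the cosets of `U^⊥` (a COUPLED
Dillon pair of flats), both cubic, then `Φ(f,g) ∈ {1} ∪ [−1, 31/32]`. (In adapted coordinates
`f = x″·G(x′) ⊕ k(x′)`, `g = y′·F(y″) ⊕ h(y″)` with `F, G` quadratic maps and
`Φ = 2^{-m} Σ_{x′} [F(G x′) = x′]·(−1)^{k(x′)+h(G x′)}`; `F∘G ⊕ id` has degree `≤ 4`, so agreement on
`> 15/16` forces `F∘G = id`, then `k ⊕ h∘G` has degree `≤ 6` and bias `> 31/32 ⇒` zero.) Stated with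
`U` given by a basis `B` and `U^⊥` by a basis `B'` (orthogonality and independence as hypotheses). -/
def AlignedCapture : Prop :=
  ∀ m : ℕ, ∀ f g : (Fin (m + m) → Bool) → Bool, IsDegLeFun 3 f → IsDegLeFun 3 g →
    ∀ B B' : Fin m → (Fin (m + m) → Bool),
      LinearIndependent (ZMod 2) (fun i => fun j => if B i j then (1 : ZMod 2) else 0) →
      LinearIndependent (ZMod 2) (fun i => fun j => if B' i j then (1 : ZMod 2) else 0) →
      (∀ i i', dotB (B i) (B' i') = false) →
      AffineOnCosets f B → AffineOnCosets g B' →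
        forrelation f g = 1 ∨ forrelation f g ≤ 31 / 32

/-- **CosetAffineExtraction** (card C, the transfer `C⁺`; conjectural, load-bearing): there is
`θ₀ < 1` such that every cubic pair with `Φ > θ₀` admits a coupled Dillon pair of flats as in
`AlignedCapture`. Together with `AlignedCapture` it gives `NearExactIsExact` with
`θ = max(θ₀, 31/32)`; at `Φ = 1` it contains the sister crux `ExactPairsMaioranaMcFarland`. -/
def CosetAffineExtraction : Prop :=
  ∃ θ₀ : ℝ, θ₀ < 1 ∧ ∀ m : ℕ, ∀ f g : (Fin (m + m) → Bool) → Bool, IsDegLeFun 3 f → IsDegLeFun 3 g →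
    θ₀ < forrelation f g →
      ∃ B B' : Fin m → (Fin (m + m) → Bool),
        LinearIndependent (ZMod 2) (fun i => fun j => if B i j then (1 : ZMod 2) else 0) ∧
        LinearIndependent (ZMod 2) (fun i => fun j => if B' i j then (1 : ZMod 2) else 0) ∧
        (∀ i i', dotB (B i) (B' i') = false) ∧
        AffineOnCosets f B ∧ AffineOnCosets g B'

/-- Sanity: the transfer closes the crux's `∀`-shape over `m + m` (the item quantifies over even `n`;
`n = m + m` is the same class). -/
example (hC : CosetAffineExtraction) (hA : AlignedCapture) :
    ∃ θ : ℝ, θ < 1 ∧ ∀ m : ℕ, ∀ f g : (Fin (m + m) → Bool) → Bool, IsDegLeFun 3 f → IsDegLeFun 3 g →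
      θ < forrelation f g → forrelation f g = 1 := by
  obtain ⟨θ₀, hθ₀, H⟩ := hC
  refine ⟨max θ₀ (31 / 32), max_lt hθ₀ (by norm_num), ?_⟩
  intro m f g hf hg hΦ
  have h0 : θ₀ < forrelation f g := lt_of_le_of_lt (le_max_left _ _) hΦ
  have h1 : (31 : ℝ) / 32 < forrelation f g := lt_of_le_of_lt (le_max_right _ _) hΦ
  obtain ⟨B, B', hB, hB', horth, hfB, hgB'⟩ := H m f g hf hg h0
  rcases hA m f g hf hg B B' hB hB' horth hfB hgB' with h | h
  · exact h
  · exact absurd h (not_le.mpr h1)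

end Summit.QuantumAdvantage.QuantumAdvantage.Cruxes.NearExactIsExact.Ideator3
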